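import Summits.QuantumFields.BalabanUV.Beta.WardLocusRecursive
import Summits.QuantumFields.BalabanUV.Beta.StepReflection

/-!
# (Sr-conj) FOR A STEP STENCIL WITH A GENERIC FIELD–FIELD CUBIC SECTOR, and for member `j+1` of the RECURSIVE family `SrecAt`,
# MODULO the field–field reflection law of the cubic sector (β sub-cell, row BETA-an2 = BINDER-OWNERS row D1, gen 16; decision (L3-D′))

HONEST FRAMING (cell charter, verbatim): «discharging BetaPertH makes Balaban's UV stability UNCONDITIONAL — a real
constructive-QFT result; it is NOT the continuum limit and NOT the Clay problem.»  DERIVED cell leaf (pub-balaban β sub-cell, lane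
an2 gen 16); no statement of Bałaban's papers is typed here, no `[cite:]` tag, no `Prop` fact; it instantiates no binder of the
β-function wall by itself.  The kernel `𝕄` (bordered shape) and the cubic ff-law are explicit HYPOTHESES.  NOT `BetaPertH`; NOT continuum;
NOT Clay.

## What is here ([folklore] bookkeeping; the proof of `StepReflection.SstepNAt_bref_of_e3Law` with the cubic sector abstracted)

* `e3OfK_inl_inr` / `_inr_inl` / `_inr_inr`: the resolvent-generic cubic jet `e3OfK N K S` lives on the field–field block (`mmRead`).
* **`cubicStep_bref_of_ffLaw`**: for a step stencil `T κ′ u′ := a • Q κ′ u′ + (cVH·wVH j) • vhSAt ρ_c κ′ u′ + (cΛ·wΛ j) • SLam Lc (lamCoeffK (KInvStep Lc j)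
  (E2 j) Lc) (hessFFAt ρ_c) κ′ u′` with ANY field–field-supported cubic sector `Q` obeying the ff-law with contact `c·conjV 𝕄 (diagK ctGen)` against a
  bordered-shape `𝕄` (border `= s ·` that of `bhKAt ρ_c Lc`, multiplier block `0`, `s ≠ 0`), and ONE normalisation `a·c = cVH·wVH j / (s·Lc^{d+1})`:
  `T κ′ (bref α κ′ u) = reflSign α κ′ • refK (Φ Lc α) (T κ′ u + conjV 𝕄 ((cVH·wVH j / (s·Lc^{d+1})) • diagK (ctGen d α Lc κ′ u)))`.
* **`SrecAt_succ_bref_of_e3Law`**: the instance `Q := e3OfK Lc G_j (SrecAt ρ_c … j)`, `a := cE·wE (j+1)` — the hypothesis hSrC of the hR wiring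
  `SpineRooted.axisReflectionCovariant_flipK_TbalOf_JsRecBmAtOf_ctrC` at member `j+1` of the recursive family, from EXACTLY the ff-law of its cubic
  sector (socket (L3) of row D1's hR binder, to be discharged level by level from the (Sr-conj) law of member `j` — the recursion).

All declarations `[folklore]`; axioms standard.  Provenance: b2b-balaban β sub-cell, unit beta-an2 gen 16, 2026-08-20 (v1); no existing file touched.
-/

open Finset
open scoped BigOperators
open Literature.MathematicalPhysics.QuantumFieldTheory
open Literature.MathematicalPhysics.QuantumFieldTheory.Balaban1983to89
open Literature.MathematicalPhysics.QuantumFieldTheory.Balaban1983to89.Beta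
open ExpKernelCalculus (MKer comp)
open AveragingContoursRooted (ctr ctrOff)
open AveragingHessianKernels (packVH packVH_inl_inl)
open AveragingHessianKernelsRooted (vhSAt hessFFAt)
open PolarizationSign (reflSign)
open KernelReflection (LegMap refK refK_apply)
open ResolventReflection (bref Φ Φ_r_inl Φ_r_inr Φ_s_inl Φ_s_inr)
open OneStepResolventKernel (Fib KInv)
open OneStepKernelFamily (KInvStep)
open InterLevelTransport (SLam)
open BalabanStepJetsSucc (mmRead E2 lamCoeffK wE wVH wΛ)
open Summit.QuantumFields.BalabanUV.Beta.ChartConjugation (conjV)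
open Summit.QuantumFields.BalabanUV.Beta.BorderedHessian (bhKAt diagK ctGen)
open Summit.QuantumFields.BalabanUV.Beta.AxialDressingRooted (coDressKBmAt)
open Summit.QuantumFields.BalabanUV.Beta.WardLocusRecursive (SrecAt SrecAt_succ)

noncomputable section

namespace Summit.QuantumFields.BalabanUV.Beta.SpineRooted

variable {d : ℕ} {Lc : ℕ} [NeZero Lc]

/-! ## §1 The resolvent-generic cubic jet lives on the field–field block -/

/-- [folklore] `e3OfK N K S κ′ w` has no field–multiplier block (`mmRead`). -/
theorem e3OfK_inl_inr (N : ℕ) (K : MKer (d + 1) (Fib d)) (S : Fin (d + 1) → (Fin (d + 1) → ℤ) → MKer (d + 1) (Fib d))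
    (κ' : Fin (d + 1)) (w x z : Fin (d + 1) → ℤ) (β μ : Fin (d + 1)) : e3OfK N K S κ' w x z (Sum.inl β) (Sum.inr μ) = 0 := by
  show -(0 : ℝ) = 0
  exact neg_zero

/-- [folklore] `e3OfK N K S κ′ w` has no multiplier–field block. -/
theorem e3OfK_inr_inl (N : ℕ) (K : MKer (d + 1) (Fib d)) (S : Fin (d + 1) → (Fin (d + 1) → ℤ) → MKer (d + 1) (Fib d))
    (κ' : Fin (d + 1)) (w x z : Fin (d + 1) → ℤ) (μ β : Fin (d + 1)) : e3OfK N K S κ' w x z (Sum.inr μ) (Sum.inl β) = 0 := by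
  show -(0 : ℝ) = 0
  exact neg_zero

/-- [folklore] `e3OfK N K S κ′ w` has no multiplier–multiplier block. -/
theorem e3OfK_inr_inr (N : ℕ) (K : MKer (d + 1) (Fib d)) (S : Fin (d + 1) → (Fin (d + 1) → ℤ) → MKer (d + 1) (Fib d))
    (κ' : Fin (d + 1)) (w x z : Fin (d + 1) → ℤ) (μ μ' : Fin (d + 1)) : e3OfK N K S κ' w x z (Sum.inr μ) (Sum.inr μ') = 0 := by
  show -(0 : ℝ) = 0
  exact neg_zero

/-! ## §2 The law for a step stencil with a generic cubic sector -/

/-- [folklore] **(Sr-conj) FOR A STEP STENCIL WITH A GENERIC FIELD–FIELD CUBIC SECTOR, MODULO ITS ff-LAW WITH CONTACT.**  Data: a cubic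
sector `Q` supported on the field–field block (`hQfm`, `hQmf`, `hQmm`) with weight `a`, the border sector `(cVH·wVH j) • vhSAt ρ_c` and the Λ
sector of `SstepNAt … j` verbatim; a bordered-shape `𝕄` (scale `s ≠ 0`: `hfm`, `hmf`, `hmm`); the ff-law `hQff` of `Q` with contact constant
`c`; the normalisation `a·c = cVH·wVH j / (s·Lc^{d+1})`.  Conclusion: the socket hSrC for `T κ′ u′ := a • Q κ′ u′ + (cVH·wVH j) • vhSAt ρ_c κ′ u′ + (Λ)`
with the contact `(cVH·wVH j / (s·Lc^{d+1})) • diagK (ctGen d α Lc κ′ u)`. -/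
theorem cubicStep_bref_of_ffLaw (hLc : Odd Lc) (cVH cΛ : ℝ) (j : ℕ) {s : ℝ} (hs : s ≠ 0) {𝕄 : MKer (d + 1) (Fib d)}
    (hfm : ∀ x z β μ, 𝕄 x z (Sum.inl β) (Sum.inr μ) = s * bhKAt d (ctr (d + 1) Lc) Lc x z (Sum.inl β) (Sum.inr μ))
    (hmf : ∀ x z μ β, 𝕄 x z (Sum.inr μ) (Sum.inl β) = s * bhKAt d (ctr (d + 1) Lc) Lc x z (Sum.inr μ) (Sum.inl β))
    (hmm : ∀ x z μ μ', 𝕄 x z (Sum.inr μ) (Sum.inr μ') = 0)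
    {Q : Fin (d + 1) → (Fin (d + 1) → ℤ) → MKer (d + 1) (Fib d)}
    (hQfm : ∀ κ' w x z β μ, Q κ' w x z (Sum.inl β) (Sum.inr μ) = 0) (hQmf : ∀ κ' w x z μ β, Q κ' w x z (Sum.inr μ) (Sum.inl β) = 0)
    (hQmm : ∀ κ' w x z μ μ', Q κ' w x z (Sum.inr μ) (Sum.inr μ') = 0) (a c : ℝ)
    (hc : a * c = cVH * wVH d Lc j / (s * (Lc : ℝ) ^ (d + 1)))
    (hQff : ∀ (α κ' : Fin (d + 1)) (u x z : Fin (d + 1) → ℤ) (β β' : Fin (d + 1)),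
      Q κ' (bref α κ' u) x z (Sum.inl β) (Sum.inl β') =
        reflSign α κ' * ((Φ Lc α).s (Sum.inl β) * (Φ Lc α).s (Sum.inl β') *
          (Q κ' u ((Φ Lc α).r (Sum.inl β) x) ((Φ Lc α).r (Sum.inl β') z) (Sum.inl β) (Sum.inl β') +
            c * conjV 𝕄 (diagK (ctGen d α Lc κ' u)) ((Φ Lc α).r (Sum.inl β) x) ((Φ Lc α).r (Sum.inl β') z) (Sum.inl β) (Sum.inl β'))))
    (T : Fin (d + 1) → (Fin (d + 1) → ℤ) → MKer (d + 1) (Fib d))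
    (hT : ∀ κ' u', T κ' u' = a • Q κ' u' + (cVH * wVH d Lc j) • vhSAt (ctr (d + 1) Lc) d Lc rfl κ' u' +
      (cΛ * wΛ d Lc j) • SLam Lc (lamCoeffK (KInvStep (d := d) Lc j) (E2 d Lc j) Lc) (fun μ y => hessFFAt (ctr (d + 1) Lc) Lc μ y) κ' u')
    (α κ' : Fin (d + 1)) (u : Fin (d + 1) → ℤ) :
    T κ' (bref α κ' u) =
      reflSign α κ' • refK (Φ Lc α) (T κ' u + conjV 𝕄 ((cVH * wVH d Lc j / (s * (Lc : ℝ) ^ (d + 1))) • diagK (ctGen d α Lc κ' u))) := by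
  -- the Λ summand: pure sign, entrywise
  have hΛ := smul_SLam_step_reflect (d := d) hLc cΛ j α κ' u
  rw [hT, hT]
  funext x z e f
  have hΛx := congrFun (congrFun (congrFun (congrFun hΛ x) z) e) f
  simp only [Pi.smul_apply, smul_eq_mul, refK_apply] at hΛx
  simp only [Pi.smul_apply, Pi.add_apply, smul_eq_mul, refK_apply, conjV_smul_right]
  rcases e with β | μ <;> rcases f with β' | μ'
  · -- field–field: the cubic sector carries the contact, vh vanishes, Λ pure sign
    rw [hQff α κ' u x z β β', hΛx]
    have hv0 := smul_vhSAt_inl_inl (Lc := Lc) (ctr (d + 1) Lc) (cVH * wVH d Lc j) κ' (bref α κ' u) x z β β'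
    have hv1 := smul_vhSAt_inl_inl (Lc := Lc) (ctr (d + 1) Lc) (cVH * wVH d Lc j) κ' u ((Φ Lc α).r (Sum.inl β) x)
      ((Φ Lc α).r (Sum.inl β') z) β β'
    simp only [Pi.smul_apply, smul_eq_mul] at hv0 hv1
    rw [hv0, hv1]
    have hc' : cVH * wVH d Lc j / (s * (Lc : ℝ) ^ (d + 1)) = a * c := hc.symm
    rw [hc']
    ring
  · -- field–multiplier: vh carries the contact, the cubic sector vanishes
    have hv := smul_vhSAt_bref_inl_inr hLc (cVH * wVH d Lc j) hs hfm α κ' u x z β μ'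
    simp only [Pi.smul_apply, Pi.add_apply, smul_eq_mul, refK_apply, conjV_smul_right] at hv
    rw [hQfm, hQfm, hv, hΛx]
    ring
  · have hv := smul_vhSAt_bref_inr_inl hLc (cVH * wVH d Lc j) hs hmf α κ' u x z μ β'
    simp only [Pi.smul_apply, Pi.add_apply, smul_eq_mul, refK_apply, conjV_smul_right] at hv
    rw [hQmf, hQmf, hv, hΛx]
    ring
  · have hv := smul_vhSAt_bref_inr_inr hLc (cVH * wVH d Lc j) (s := s) hmm α κ' u x z μ μ'
    simp only [Pi.smul_apply, Pi.add_apply, smul_eq_mul, refK_apply, conjV_smul_right] at hv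
    rw [hQmm, hQmm, hv, hΛx]
    ring

/-! ## §3 Member `j+1` of the recursive family -/

/-- [folklore] **(Sr-conj) AT MEMBER `j+1` OF THE RECURSIVE FAMILY `SrecAt ρ_c`, MODULO THE ff-LAW OF ITS CUBIC SECTOR.**  With
`G_j := coDressKBmAt ρ_c Lc (KInvStep Lc j)`: if `e3OfK Lc G_j (SrecAt ρ_c … j)` obeys the ff-law with contact `c·conjV 𝕄 (diagK ctGen)` against a
bordered-shape `𝕄` (scale `s ≠ 0`) and `cE·wE (j+1)·c = cVH·wVH (j+1) / (s·Lc^{d+1})`, then for every `α κ′ u`,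
`SrecAt … (j+1) κ′ (bref α κ′ u) = reflSign α κ′ • refK (Φ Lc α) (SrecAt … (j+1) κ′ u + conjV 𝕄 ((cVH·wVH (j+1) / (s·Lc^{d+1})) • diagK (ctGen d α Lc κ′ u)))`
— the hypothesis hSrC of `SpineRooted.axisReflectionCovariant_flipK_TbalOf_JsRecBmAtOf_ctrC` at member `j+1`. -/
theorem SrecAt_succ_bref_of_e3Law (hLc : Odd Lc) (cE cVH cΛ : ℝ) (j : ℕ) {s : ℝ} (hs : s ≠ 0) {𝕄 : MKer (d + 1) (Fib d)}
    (hfm : ∀ x z β μ, 𝕄 x z (Sum.inl β) (Sum.inr μ) = s * bhKAt d (ctr (d + 1) Lc) Lc x z (Sum.inl β) (Sum.inr μ))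
    (hmf : ∀ x z μ β, 𝕄 x z (Sum.inr μ) (Sum.inl β) = s * bhKAt d (ctr (d + 1) Lc) Lc x z (Sum.inr μ) (Sum.inl β))
    (hmm : ∀ x z μ μ', 𝕄 x z (Sum.inr μ) (Sum.inr μ') = 0) (c : ℝ)
    (hc : cE * wE d Lc (j + 1) * c = cVH * wVH d Lc (j + 1) / (s * (Lc : ℝ) ^ (d + 1)))
    (hE3ff : ∀ (α κ' : Fin (d + 1)) (u x z : Fin (d + 1) → ℤ) (β β' : Fin (d + 1)),
      e3OfK Lc (coDressKBmAt (ctr (d + 1) Lc) Lc (KInvStep (d := d) Lc j)) (SrecAt d Lc (ctr (d + 1) Lc) cE cVH cΛ j) κ' (bref α κ' u)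
          x z (Sum.inl β) (Sum.inl β') =
        reflSign α κ' * ((Φ Lc α).s (Sum.inl β) * (Φ Lc α).s (Sum.inl β') *
          (e3OfK Lc (coDressKBmAt (ctr (d + 1) Lc) Lc (KInvStep (d := d) Lc j)) (SrecAt d Lc (ctr (d + 1) Lc) cE cVH cΛ j) κ' u
              ((Φ Lc α).r (Sum.inl β) x) ((Φ Lc α).r (Sum.inl β') z) (Sum.inl β) (Sum.inl β') +
            c * conjV 𝕄 (diagK (ctGen d α Lc κ' u)) ((Φ Lc α).r (Sum.inl β) x) ((Φ Lc α).r (Sum.inl β') z) (Sum.inl β) (Sum.inl β'))))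
    (α κ' : Fin (d + 1)) (u : Fin (d + 1) → ℤ) :
    SrecAt d Lc (ctr (d + 1) Lc) cE cVH cΛ (j + 1) κ' (bref α κ' u) =
      reflSign α κ' • refK (Φ Lc α) (SrecAt d Lc (ctr (d + 1) Lc) cE cVH cΛ (j + 1) κ' u +
        conjV 𝕄 ((cVH * wVH d Lc (j + 1) / (s * (Lc : ℝ) ^ (d + 1))) • diagK (ctGen d α Lc κ' u))) :=
  cubicStep_bref_of_ffLaw hLc cVH cΛ (j + 1) hs hfm hmf hmm
    (Q := e3OfK Lc (coDressKBmAt (ctr (d + 1) Lc) Lc (KInvStep (d := d) Lc j)) (SrecAt d Lc (ctr (d + 1) Lc) cE cVH cΛ j))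
    (fun κ' w x z β μ => e3OfK_inl_inr _ _ _ κ' w x z β μ) (fun κ' w x z μ β => e3OfK_inr_inl _ _ _ κ' w x z μ β)
    (fun κ' w x z μ μ' => e3OfK_inr_inr _ _ _ κ' w x z μ μ') (cE * wE d Lc (j + 1)) c hc hE3ff
    (SrecAt d Lc (ctr (d + 1) Lc) cE cVH cΛ (j + 1)) (fun κ' u' => by rw [SrecAt_succ]) α κ' u

end Summit.QuantumFields.BalabanUV.Beta.SpineRooted

end
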